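import Mathlib.InformationTheory.KullbackLeibler.Basic
import Mathlib.MeasureTheory.Measure.Prod
import Mathlib.Analysis.SpecialFunctions.Pow.Real
import Mathlib.Analysis.SpecialFunctions.Sqrt
import HarnessLib

/-!
# The squared Hellinger distance is dominated by the Kullback–Leibler divergence

Topic `Literature/Probability/Divergences`; companion of `FDivergence.lean` (where `sqHellingerDiv` and
`klDiv_eq_fDiv` live) stated directly for Mathlib's `InformationTheory.klDiv`, in the `ℝ≥0∞`-integral
form that needs no integrability bookkeeping:

* `lintegral_sqrt_rnDeriv_sub_one_sq_le_klDiv` — `H²(μ, ν) = ∫ (√(dμ/dν) - 1)² dν ≤ KL(μ ‖ ν)` for finite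
  measures `μ ≪ ν` (pointwise `(√p - 1)² ≤ p log p + 1 - p`);
* `lintegral_sqrt_rnDeriv_sub_sqrt_fst_sq_le_klDiv` — the DISINTEGRATED form on a product `X × Y` with
  reference `m = μ ⊗ κ` (`κ` a probability measure): for a finite `f ≪ m` with density `ρ = df/dm` and
  first-marginal density `n = df₁/dμ`,
  `∫∫ (√ρ(x, y) - √n(x))² κ(dy) μ(dx) ≤ KL(f ‖ f₁ ⊗ κ)` (chain rule `ρ = (df/d(f₁ ⊗ κ)) · n` a.e.) — the
  form in which the "local equilibrium" `f₁ ⊗ κ` of a one-body law enters kinetic entropy methods.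

[cite: PolyanskiyWu2024, §7.3 (H² ≤ KL)]
-/

noncomputable section

open _root_.MeasureTheory _root_.InformationTheory Set
open scoped ENNReal

namespace Literature.Probability.Divergences

variable {X : Type*} [MeasurableSpace X]

/-- **Hellinger is dominated by Kullback–Leibler**: for finite measures `μ ≪ ν`,
`H²(μ, ν) = ∫ (√(dμ/dν) - 1)² dν ≤ KL(μ ‖ ν)` (as `ℝ≥0∞`-integrals; `klDiv = ∫ klFun (dμ/dν) dν`).
[cite: PolyanskiyWu2024, §7.3] -/
theorem lintegral_sqrt_rnDeriv_sub_one_sq_le_klDiv (μ ν : Measure X) [IsFiniteMeasure μ]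
    [IsFiniteMeasure ν] (hμν : μ ≪ ν) :
    ∫⁻ x, ENNReal.ofReal ((Real.sqrt ((μ.rnDeriv ν x).toReal) - 1) ^ 2) ∂ν ≤ klDiv μ ν := by
  -- pointwise: `(√p - 1)² ≤ klFun p` for `p ≥ 0` (from `log t ≤ t - 1` at `t = 1/√p`)
  have hpt : ∀ {p : ℝ}, 0 ≤ p → (Real.sqrt p - 1) ^ 2 ≤ klFun p := by
    intro p hp0
    rw [klFun_apply]
    rcases hp0.eq_or_lt with h0 | hpos
    · rw [← h0]; simp
    · set t : ℝ := Real.sqrt p with ht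
      have ht0 : 0 < t := Real.sqrt_pos.2 hpos
      have htp : t ^ 2 = p := Real.sq_sqrt hp0
      have hlog : Real.log p = 2 * Real.log t := by
        rw [← htp, Real.log_pow]; norm_num
      have h1 : Real.log t⁻¹ ≤ t⁻¹ - 1 := Real.log_le_sub_one_of_pos (inv_pos.2 ht0)
      rw [Real.log_inv] at h1
      have h2 : t - 1 ≤ t * Real.log t := by
        have := mul_le_mul_of_nonneg_left h1 ht0.le
        rw [mul_sub, mul_inv_cancel₀ ht0.ne', mul_one, mul_neg] at this
        linarith
      rw [hlog, ← htp]
      nlinarith [h2, ht0]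
  rw [klDiv_eq_lintegral_klFun_of_ac hμν]
  exact lintegral_mono fun x => ENNReal.ofReal_le_ofReal (hpt ENNReal.toReal_nonneg)

variable {Y : Type*} [MeasurableSpace Y]

/-- **Disintegrated Hellinger–Kullback bound on a product.** Let `m = μ ⊗ κ` with `μ` σ-finite and `κ`
a probability measure, and let `f` be a finite measure on `X × Y` with `f ≪ m`, density `ρ = df/dm`
and first-marginal density `n = df₁/dμ`. Then
`∫∫ (√ρ(x, y) - √n(x))² κ(dy) μ(dx) ≤ KL(f ‖ f₁ ⊗ κ)`.
Proof: if `f ≪ f₁ ⊗ κ` (else `KL = ∞`), the chain rule gives `ρ = p · n` `m`-a.e. with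
`p = df/d(f₁ ⊗ κ)` (`f₁ ⊗ κ = m.withDensity (n ∘ fst)`), so the integrand is `n (√p - 1)²` and the
claim is `H²(f, f₁ ⊗ κ) ≤ KL(f ‖ f₁ ⊗ κ)`. [cite: PolyanskiyWu2024, §7.3] -/
theorem lintegral_sqrt_rnDeriv_sub_sqrt_fst_sq_le_klDiv (μ : Measure X) (κ : Measure Y) [SigmaFinite μ]
    [IsProbabilityMeasure κ] (f : Measure (X × Y)) [IsFiniteMeasure f] (hf : f ≪ μ.prod κ) :
    ∫⁻ x, ∫⁻ y, ENNReal.ofReal ((Real.sqrt ((f.rnDeriv (μ.prod κ) (x, y)).toReal) -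
        Real.sqrt ((f.fst.rnDeriv μ x).toReal)) ^ 2) ∂κ ∂μ ≤ klDiv f (f.fst.prod κ) := by
  set ν : Measure (X × Y) := f.fst.prod κ with hν
  by_cases hfν : f ≪ ν
  swap
  · rw [klDiv_of_not_ac hfν]; exact le_top
  set N : X → ℝ≥0∞ := f.fst.rnDeriv μ with hN
  have hNm : Measurable N := Measure.measurable_rnDeriv _ _
  -- `f₁ ≪ μ` and `ν = m.withDensity (n ∘ fst)`
  have hf1 : f.fst ≪ μ := by
    have h : f.map Prod.fst ≪ (μ.prod κ).map Prod.fst := hf.map measurable_fst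
    have h2 : (μ.prod κ).map Prod.fst = μ := by rw [← Measure.fst, Measure.fst_prod]
    rwa [h2] at h
  have hνeq : ν = (μ.prod κ).withDensity (fun z => N z.1) := by
    rw [hν, ← prod_withDensity_left hNm, hN, Measure.withDensity_rnDeriv_eq _ _ hf1]
  haveI : IsFiniteMeasure ν := by rw [hν]; infer_instance
  have hνr : ν.rnDeriv (μ.prod κ) =ᵐ[μ.prod κ] fun z => N z.1 := by
    rw [hνeq]
    exact Measure.rnDeriv_withDensity _ (hNm.comp measurable_fst)
  have hchain := Measure.rnDeriv_mul_rnDeriv hfν (κ := μ.prod κ)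
  have hNtop : ∀ᵐ z ∂(μ.prod κ), N z.1 < ∞ :=
    (Measure.quasiMeasurePreserving_fst (μ := μ) (ν := κ)).ae (Measure.rnDeriv_lt_top _ _)
  -- the integrand, a.e.
  have hpt : ∀ᵐ z ∂(μ.prod κ), ENNReal.ofReal ((Real.sqrt ((f.rnDeriv (μ.prod κ) z).toReal) -
      Real.sqrt ((N z.1).toReal)) ^ 2) =
      N z.1 * ENNReal.ofReal ((Real.sqrt ((f.rnDeriv ν z).toReal) - 1) ^ 2) := by
    filter_upwards [hνr, hchain, hNtop] with z hz1 hz2 hz3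
    rw [← hz2, Pi.mul_apply, hz1, ENNReal.toReal_mul, Real.sqrt_mul ENNReal.toReal_nonneg,
      ← ENNReal.ofReal_toReal hz3.ne, ENNReal.toReal_ofReal ENNReal.toReal_nonneg,
      ← ENNReal.ofReal_mul ENNReal.toReal_nonneg]
    congr 1
    have h0 : 0 ≤ (N z.1).toReal := ENNReal.toReal_nonneg
    calc (Real.sqrt ((f.rnDeriv ν z).toReal) * Real.sqrt ((N z.1).toReal) - Real.sqrt ((N z.1).toReal)) ^ 2
        = Real.sqrt ((N z.1).toReal) ^ 2 * (Real.sqrt ((f.rnDeriv ν z).toReal) - 1) ^ 2 := by ring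
      _ = _ := by rw [Real.sq_sqrt h0]
  have hmeas : Measurable fun z : X × Y => ENNReal.ofReal ((Real.sqrt ((f.rnDeriv (μ.prod κ) z).toReal) -
      Real.sqrt ((N z.1).toReal)) ^ 2) :=
    (((Measure.measurable_rnDeriv _ _).ennreal_toReal.sqrt).sub
      ((hNm.comp measurable_fst).ennreal_toReal.sqrt)).pow_const _ |>.ennreal_ofReal
  have hwd : ∀ F : X × Y → ℝ≥0∞, Measurable F → ∫⁻ z, F z ∂ν = ∫⁻ z, N z.1 * F z ∂(μ.prod κ) := by
    intro F hF
    rw [hνeq, lintegral_withDensity_eq_lintegral_mul₀ (f := fun z : X × Y => N z.1)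
      (hNm.comp measurable_fst).aemeasurable hF.aemeasurable]
    rfl
  calc ∫⁻ x, ∫⁻ y, ENNReal.ofReal ((Real.sqrt ((f.rnDeriv (μ.prod κ) (x, y)).toReal) -
        Real.sqrt ((N x).toReal)) ^ 2) ∂κ ∂μ
      = ∫⁻ z, ENNReal.ofReal ((Real.sqrt ((f.rnDeriv (μ.prod κ) z).toReal) -
          Real.sqrt ((N z.1).toReal)) ^ 2) ∂(μ.prod κ) := (lintegral_prod _ hmeas.aemeasurable).symm
    _ = ∫⁻ z, N z.1 * ENNReal.ofReal ((Real.sqrt ((f.rnDeriv ν z).toReal) - 1) ^ 2) ∂(μ.prod κ) :=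
        lintegral_congr_ae hpt
    _ = ∫⁻ z, ENNReal.ofReal ((Real.sqrt ((f.rnDeriv ν z).toReal) - 1) ^ 2) ∂ν :=
        (hwd _ (((Measure.measurable_rnDeriv _ _).ennreal_toReal.sqrt.sub_const _).pow_const _
            |>.ennreal_ofReal)).symm
    _ ≤ klDiv f ν := lintegral_sqrt_rnDeriv_sub_one_sq_le_klDiv f ν hfν

end Literature.Probability.Divergences

end
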